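import Mathlib
import HarnessLib

/-!
# Stub `stub_aeOrbitMem` of the line `SketchIdeator5`
# (crux `WazewskiBlock.UniformGalerkinTrap`, stmt-AnomalousDissipation-10352)

Sorry-free discharge of the registered abstract stub `stub_aeOrbitMem` of the lead's skeleton
(`Cruxes/UniformGalerkinTrap/Lines/SketchIdeator5.lean`): an invariant probability law of a semiflow carried by a
closed set `K` (`μ Kᶜ = 0`) has `μ`-a.e. forward orbit inside `K` for ALL times `t ≥ 0`.

**Proof.**  For a fixed time `t ≥ 0`, invariance `μ.map (φ t) = μ` transports `μ Kᶜ = 0` to `μ`-a.e.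
`φ t x ∈ K` (`MeasureTheory.ae_of_ae_map`; no measurability of `K` is needed).  Countably many null sets
(`MeasureTheory.ae_all_iff` over `ℚ`) give `μ`-a.e. `x` with `φ q x ∈ K` for every rational `q ≥ 0`.  For such an
`x` the set `[0,∞) ∩ {s | φ s x ∈ K}` is closed (`ContinuousOn.preimage_isClosed_of_isClosed`, orbit continuity on
`[0,∞)` and closedness of `K`) and contains the nonnegative rationals, which accumulate at every `t ≥ 0` from the
right (`exists_rat_btwn`), hence it contains every `t ≥ 0`.  Pure measure theory / topology. [folklore]
-/

noncomputable section

-- `Summit.<Summit>.<Problem>` is the tree's mandated summit-side namespace (CONVENTIONS §2); deliberate duplicate.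
set_option linter.dupNamespace false

namespace Summit.AnomalousDissipation.AnomalousDissipation.Theorems.UniformGalerkinTrap.Mane

open MeasureTheory Set Filter Topology

/-- **One fixed time.** If the time-`t` map is measurable and preserves `μ`, and `μ Kᶜ = 0`, then `μ`-a.e.
`φ t x ∈ K` (pull back the co-null set `K` along `φ t` through `μ.map (φ t) = μ`). [folklore] -/
theorem ae_mem_of_map_eq {X : Type*} [MeasurableSpace X] {φ : ℝ → X → X} {μ : Measure X} {K : Set X}
    {t : ℝ} (hmeas : Measurable (φ t)) (hinv : μ.map (φ t) = μ) (hK : μ Kᶜ = 0) :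
    ∀ᵐ x ∂μ, φ t x ∈ K := by
  have h : ∀ᵐ y ∂(μ.map (φ t)), y ∈ K := by
    rw [hinv]
    exact Filter.eventually_mem_set.2 (mem_ae_iff.2 hK)
  exact ae_of_ae_map hmeas.aemeasurable h

/-- **All nonnegative rational times at once.** Under measurability and invariance of the time-`t` maps (`t ≥ 0`)
and `μ Kᶜ = 0`, `μ`-a.e. `x` satisfies `φ q x ∈ K` for every rational `q ≥ 0` (countable union of null sets).
[folklore] -/
theorem ae_forall_rat_mem {X : Type*} [MeasurableSpace X] {φ : ℝ → X → X} {μ : Measure X} {K : Set X}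
    (hmeas : ∀ t : ℝ, 0 ≤ t → Measurable (φ t)) (hinv : ∀ t : ℝ, 0 ≤ t → μ.map (φ t) = μ)
    (hK : μ Kᶜ = 0) : ∀ᵐ x ∂μ, ∀ q : ℚ, 0 ≤ (q : ℝ) → φ q x ∈ K := by
  refine ae_all_iff.2 fun q => ?_
  by_cases hq : 0 ≤ (q : ℝ)
  · filter_upwards [ae_mem_of_map_eq (hmeas q hq) (hinv q hq) hK] with x hx
    exact fun _ => hx
  · exact Eventually.of_forall fun x h => absurd h hq

/-- **From rational to all times along one orbit.** If an orbit `s ↦ φ s x` is continuous on `[0,∞)`, `K` is closed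
and `φ q x ∈ K` for every rational `q ≥ 0`, then `φ t x ∈ K` for every real `t ≥ 0`: the good nonnegative times
form a closed set containing a set accumulating at `t` from the right. [folklore] -/
theorem mem_of_forall_rat_mem {X : Type*} [TopologicalSpace X] {φ : ℝ → X → X} {K : Set X} {x : X}
    (hcont : ContinuousOn (fun t => φ t x) (Set.Ici 0)) (hKc : IsClosed K)
    (hx : ∀ q : ℚ, 0 ≤ (q : ℝ) → φ q x ∈ K) {t : ℝ} (ht : 0 ≤ t) : φ t x ∈ K := by
  have hA : IsClosed (Ici (0 : ℝ) ∩ (fun s => φ s x) ⁻¹' K) :=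
    hcont.preimage_isClosed_of_isClosed isClosed_Ici hKc
  have htA : t ∈ closure (Ici (0 : ℝ) ∩ (fun s => φ s x) ⁻¹' K) := by
    rw [Metric.mem_closure_iff]
    intro ε hε
    obtain ⟨q, htq, hqt⟩ := exists_rat_btwn (show t < t + ε by linarith)
    refine ⟨q, ⟨mem_Ici.2 (ht.trans htq.le), hx q (ht.trans htq.le)⟩, ?_⟩
    rw [Real.dist_eq, abs_sub_comm, abs_of_pos (by linarith)]
    linarith
  rw [hA.closure_eq] at htA
  exact htA.2

/-- **A.e. forward orbits of an invariant law carried by a closed set stay in it.** For a semiflow `φ` with measurable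
time-`t` maps and forward orbits continuous on `[0,∞)`, a `φ`-invariant probability measure `μ` and a closed `K` with
`μ Kᶜ = 0`: `μ`-a.e. `x` has `φ_t x ∈ K` for all `t ≥ 0` (rational times by invariance, countably many null sets; all
times by orbit continuity and closedness). [folklore] -/
theorem stub_aeOrbitMem :
    ∀ {X : Type*} [TopologicalSpace X] [MeasurableSpace X] (φ : ℝ → X → X) (μ : Measure X)
      [IsProbabilityMeasure μ] (K : Set X),
      (∀ t : ℝ, 0 ≤ t → Measurable (φ t)) → (∀ x, φ 0 x = x) →
      (∀ x, ContinuousOn (fun t => φ t x) (Set.Ici 0)) →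
      (∀ t : ℝ, 0 ≤ t → μ.map (φ t) = μ) → IsClosed K → μ Kᶜ = 0 →
      ∀ᵐ x ∂μ, ∀ t : ℝ, 0 ≤ t → φ t x ∈ K := by
  intro X _ _ φ μ _ K hmeas _ hcont hinv hKc hK
  filter_upwards [ae_forall_rat_mem hmeas hinv hK] with x hx
  intro t ht
  exact mem_of_forall_rat_mem (hcont x) hKc hx ht

end Summit.AnomalousDissipation.AnomalousDissipation.Theorems.UniformGalerkinTrap.Mane

end
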